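import Literature.Geometry.Kaehler.ComplexTorusCoordForms
import Literature.Geometry.Kaehler.ComplexTorusHolomorphicOneForms
import HarnessLib

/-!
# Coordinate one-forms `dxₐ` of a complex torus: the basis of `Alt¹_ℝ(E; ℂ)` and the rational representation

Degree-one companion of `Literature/Geometry/Kaehler/ComplexTorusCoordForms.lean` (which treats the
coordinate `2`-forms `ε_{ab} = dxₐ ∧ dx_b`). For a period isomorphism `Φ : ℝ^ι ≃ E` of the complex
torus `X = E/Φ(ℤ^ι)` and the lattice coordinates `xₐ = eₐ* ∘ Φ⁻¹` (`ComplexTorus.coord`), the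
complex-valued coordinate one-forms `dxₐ ∈ Alt¹_ℝ(E; ℂ)` (`ComplexTorus.dx`) satisfy
(Lange–Birkenhake, *Complex Abelian Varieties*, §1.1.3 Lemma 1.1.17 and §1.1.4 Prop. 1.1.20: "the
classes of the forms `dx_{i₁} ∧ ⋯ ∧ dx_{iₙ}` form a basis", here `n = 1`; §1.1.2: the rational
representation `ρᵣ`):

* `dx_apply_single` — `dxₐ(Φe_b) = δ_{ab}`; `eq_sum_apply_smul_dx` — every `ω ∈ Alt¹_ℝ(E; ℂ)` is
  `Σₐ ω(Φeₐ) • dxₐ`; `linearIndependent_dx`, `span_dx_eq_top` (the `dxₐ` form a `ℂ`-basis of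
  `Alt¹_ℝ(E; ℂ)` with coordinates `ω ↦ ω(Φeₐ)`), `finrank_alt_one`;
* `dx_comp_realRep` — **`dxₐ ∘ ρ(A) = Σ_c A_{ac} dx_c`** for the real analytic representation
  `ρ(A) = realRep Φ Φ A = Φ A Φ⁻¹` of the endomorphism `mapMatrix A` of an integer matrix `A`;
* `comp_realRep_elementary₁` — for the rank-one integer matrix `B` with `Be_c = eₐ` and `Be_k = 0`
  (`k ≠ c`): `ω ∘ ρ(B) = ω(Φeₐ) • dx_c` (every lattice coordinate of `ω` is moved onto every `dx_c`);
* `dx_eq_oneForm` — `dxₐ` is the one-form (`oneForm`) of the real functional `xₐ`, and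
  `sum_smul_dx_eq_oneForm`: `Σₐ zₐ • dxₐ = oneForm (Σₐ zₐ • xₐ)`.

Everything is proved; no named fact. Consumer: the rational structure of `H¹` of an algebraic
complex torus (`HodgeTheory/ComplexTorusRationalOneForms`).

## References

* [LangeBirkenhake1992] H. Lange, Ch. Birkenhake, Complex Abelian Varieties, §1.1.2, §1.1.3
  Lemma 1.1.17, §1.1.4 Prop. 1.1.20.
-/

noncomputable section

open scoped Manifold

namespace Literature.Geometry.Kaehler

namespace ComplexTorus

variable {ι : Type*} {E : Type*} [NormedAddCommGroup E] [NormedSpace ℂ E] (Φ : (ι → ℝ) ≃L[ℝ] E)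

/-! ### Values and expansion -/

/-- `dxₐ(Φ e_b) = δ_{ab}`. [cite: LangeBirkenhake1992, §1.1.4] -/
theorem dx_apply_single [DecidableEq ι] (a b : ι) :
    dx Φ a ![Φ (Pi.single b (1 : ℝ))] = if a = b then 1 else 0 := by
  rw [dx_apply, Matrix.cons_val_zero, ContinuousLinearEquiv.symm_apply_apply, Pi.single_apply]
  split_ifs <;> simp

/-- `dxₐ` is the invariant one-form of the real functional `xₐ` (viewed complex-valued). [folklore] -/
theorem dx_eq_oneForm (a : ι) : dx Φ a = oneForm (Complex.ofRealCLM.comp (coord Φ a)) := rfl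

/-- A one-form is evaluation of its functional: `ω v = ω (v₀, v₀-constant)`. [folklore] -/
theorem apply_eq_apply_const (ω : E [⋀^Fin 1]→L[ℝ] ℂ) (v : Fin 1 → E) : ω v = ω fun _ => v 0 := by
  congr 1
  funext i
  rw [Fin.fin_one_eq_zero i]

variable [Fintype ι]

/-- **Expansion in coordinate one-forms**: `ω = Σₐ ω(Φeₐ) • dxₐ` for every `ω ∈ Alt¹_ℝ(E; ℂ)`
(`v = Σₐ xₐ(v) Φeₐ` and `ω` is real-linear). [cite: LangeBirkenhake1992, §1.1.4 Prop. 1.1.20] -/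
theorem eq_sum_apply_smul_dx [DecidableEq ι] (ω : E [⋀^Fin 1]→L[ℝ] ℂ) :
    ω = ∑ a, ω ![Φ (Pi.single a (1 : ℝ))] • dx Φ a := by
  ext v
  rw [apply_eq_apply_const, ContinuousAlternatingMap.sum_apply]
  have hv := eq_sum_coord_smul Φ (v 0)
  have h1 : ω (fun _ : Fin 1 => v 0) = oneForm.symm ω (v 0) := (oneForm_symm_apply ω (v 0)).symm
  rw [h1]
  conv_lhs => rw [hv]
  rw [map_sum]
  refine Finset.sum_congr rfl fun a _ => ?_
  rw [ContinuousLinearMap.map_smul, ContinuousAlternatingMap.smul_apply, dx_apply, smul_eq_mul,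
    oneForm_symm_apply, Complex.real_smul, mul_comm]
  congr 1
  exact congrArg ω (funext fun i => by rw [Fin.fin_one_eq_zero i]; rfl)

/-- **The coordinate one-forms are linearly independent** over `ℂ` (evaluate at `Φe_b`).
[cite: LangeBirkenhake1992, §1.1.4 Prop. 1.1.20] -/
theorem linearIndependent_dx : LinearIndependent ℂ (dx Φ) := by
  classical
  rw [Fintype.linearIndependent_iff]
  intro c hc b
  have h := congrArg (fun ω : E [⋀^Fin 1]→L[ℝ] ℂ => ω ![Φ (Pi.single b (1 : ℝ))]) hc
  simp only [ContinuousAlternatingMap.sum_apply, ContinuousAlternatingMap.smul_apply, dx_apply_single,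
    smul_eq_mul, mul_ite, mul_one, mul_zero, Finset.sum_ite_eq', Finset.mem_univ, if_true,
    ContinuousAlternatingMap.coe_zero, Pi.zero_apply] at h
  exact h

/-- The coordinate one-forms span `Alt¹_ℝ(E; ℂ)`. [cite: LangeBirkenhake1992, §1.1.4 Prop. 1.1.20] -/
theorem span_dx_eq_top : Submodule.span ℂ (Set.range (dx Φ)) = ⊤ := by
  classical
  rw [eq_top_iff]
  intro ω _
  rw [eq_sum_apply_smul_dx Φ ω]
  exact Submodule.sum_mem _ fun a _ => Submodule.smul_mem _ _ (Submodule.subset_span ⟨a, rfl⟩)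

include Φ in
/-- `dim_ℂ Alt¹_ℝ(E; ℂ) = |ι|` (`= 2g`). [cite: LangeBirkenhake1992, §1.1.3 Lemma 1.1.17] -/
theorem finrank_alt_one : Module.finrank ℂ (E [⋀^Fin 1]→L[ℝ] ℂ) = Fintype.card ι := by
  rw [Module.finrank_eq_card_basis (Module.Basis.mk (linearIndependent_dx Φ) (span_dx_eq_top Φ).ge)]

/-- `Σₐ zₐ • dxₐ` is the one-form of the functional `Σₐ zₐ • xₐ`. [folklore] -/
theorem sum_smul_dx_eq_oneForm (z : ι → ℂ) :
    ∑ a, z a • dx Φ a = oneForm (∑ a, z a • Complex.ofRealCLM.comp (coord Φ a)) := by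
  rw [map_sum]
  refine Finset.sum_congr rfl fun a _ => ?_
  rw [map_smul, dx_eq_oneForm]

/-! ### The rational representation on coordinate one-forms -/

/-- **`dxₐ ∘ ρ(A) = Σ_c A_{ac} dx_c`** for every integer matrix `A` (`ρ(A) = realRep Φ Φ A`; the
transpose of the rational representation acts on `H¹ = Hom(Λ, ℤ)`, Lange–Birkenhake §1.1.2 and
Lemma 1.1.17). [cite: LangeBirkenhake1992, §1.1.2 and §1.1.3 Lemma 1.1.17] -/
theorem dx_comp_realRep (A : Matrix ι ι ℤ) (a : ι) :
    (dx Φ a).compContinuousLinearMap (realRep Φ Φ A) = ∑ c, (A a c : ℂ) • dx Φ c := by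
  ext v
  rw [ContinuousAlternatingMap.compContinuousLinearMap_apply, dx_apply, Function.comp_apply,
    ← coord_apply, coord_realRep, ContinuousAlternatingMap.sum_apply]
  push_cast
  refine Finset.sum_congr rfl fun c _ => ?_
  rw [ContinuousAlternatingMap.smul_apply, dx_apply, coord_apply, smul_eq_mul]

/-- **The elementary computation in degree one**: for `a, c : ι`, the rank-one integer matrix `B`
with `Be_c = eₐ` and `Be_k = 0` for `k ≠ c` satisfies `ω ∘ ρ(B) = ω(Φeₐ) • dx_c` for every
`ω ∈ Alt¹_ℝ(E; ℂ)`. [cite: LangeBirkenhake1992, §1.1.2] -/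
theorem comp_realRep_elementary₁ [DecidableEq ι] (ω : E [⋀^Fin 1]→L[ℝ] ℂ) (a c : ι) :
    ω.compContinuousLinearMap (realRep Φ Φ (Matrix.of fun i j =>
        if j = c then (if i = a then (1 : ℤ) else 0) else 0)) =
      ω ![Φ (Pi.single a (1 : ℝ))] • dx Φ c := by
  set B : Matrix ι ι ℤ := Matrix.of fun i j => if j = c then (if i = a then (1 : ℤ) else 0) else 0
    with hB
  -- `ρ(B) v = x_c(v) • Φ eₐ`
  have hρ : ∀ v : E, realRep Φ Φ B v = (Φ.symm v c) • Φ (Pi.single a (1 : ℝ)) := by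
    intro v
    have h := realRep_apply (Φ := Φ) (Φ' := Φ) B (Φ.symm v)
    rw [ContinuousLinearEquiv.apply_symm_apply] at h
    rw [h, ← map_smul]
    congr 1
    funext i
    simp only [Matrix.mulVec, dotProduct, Matrix.map_apply, hB, Matrix.of_apply, Pi.smul_apply,
      Pi.single_apply, smul_eq_mul]
    rw [Finset.sum_eq_single c (fun j _ hj => by rw [if_neg hj, Int.cast_zero, zero_mul])
      (fun h => absurd (Finset.mem_univ c) h)]
    rw [if_pos rfl]
    split_ifs <;> simp [mul_comm]
  obtain ⟨ℓ, rfl⟩ : ∃ ℓ : E →L[ℝ] ℂ, oneForm ℓ = ω := ⟨oneForm.symm ω, oneForm.apply_symm_apply ω⟩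
  ext v
  rw [ContinuousAlternatingMap.compContinuousLinearMap_apply, oneForm_apply, Function.comp_apply, hρ,
    ContinuousLinearMap.map_smul, ContinuousAlternatingMap.smul_apply, oneForm_apply, dx_apply,
    Matrix.cons_val_zero, smul_eq_mul, Complex.real_smul, mul_comm]

end ComplexTorus

end Literature.Geometry.Kaehler

end
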